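import Summits.Ventures.PercRepro.RankLevelSetThetaStarTwelve
import Summits.Ventures.PercRepro.RankLevelSetUpSeriesClassDual
import Summits.Ventures.PercRepro.RankLevelSetThroughMinor

/-! # RankLevelSetThetaStarUpFive — (↑)₅ HOLDS ON THE STAR WITH A PARALLEL CENTRE WHILE ITS RESIDUE FAILS (night-1
g43; dossier §55.5; COMPUTATIONAL: the two counts are checked by `native_decide`)

On `star12` (the eleven-point star with a parallel copy `11` of its centre `0`, `RankLevelSetThetaStarTwelve`), the
bi-spanning `5`-sets through `1` number `158` (**`star12_count_through_one`**) and the bi-spanning `6`-sets avoiding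
`1` number `272` (**`star12_count_six_avoid_one`**). Since the bi-independent sets of the dual are the bi-spanning sets
(`biIndep_eq_biSpan_dual`), this is **`biIndepUpAt_star12_dual : BiIndepUpAt star12✶ 1 5`** — the conclusion (↑)₅ of
p751407's `upAt_five_of_seriesPair_of_theta` holds at `b = 1` on the very instance where its hypothesis
`UpFiveSeriesPairTheta star12 0 1` is false (`not_upFiveSeriesPairTheta_star12`): the reduction (↑)₅ ⟸ (Θ) of
dossier §54.2 is one-way, and the `12`-element case of (P) is not refuted by the star. Every declaration has a
docstring; imports: the cell's own modules and Mathlib only. Axioms: standard plus the per-declaration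
`native_decide` axioms. -/

namespace PercRepro

namespace Star12

open Set Matroid

/-- The complement of a finite set in the ground set of `star12`, as a finite set. -/
theorem ground_sdiff_coe (W : Finset (Fin 12)) :
    star12.E \ (W : Set (Fin 12)) = ((Finset.univ \ W : Finset (Fin 12)) : Set (Fin 12)) := by
  rw [star12_ground, Finset.coe_sdiff, Finset.coe_univ]

/-- **The transfer of a `biSpan`-count of `star12` to a `Finset` computation**, at any level `k`. -/
theorem biSpan_count_eq (k : ℕ) (P : Finset (Fin 12) → Prop) [DecidablePred P] (P' : Set (Fin 12) → Prop)
    (hP : ∀ W : Finset (Fin 12), P' (W : Set (Fin 12)) ↔ P W) :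
    {W ∈ biSpan star12 k | P' W}.ncard = (Finset.univ.filter (fun W : Finset (Fin 12) =>
      (W.card = k ∧ spanDec W ∧ spanDec (Finset.univ \ W)) ∧ P W)).card := by
  classical
  rw [← Set.ncard_coe_finset]
  symm
  refine Set.ncard_congr (fun W _ => (W : Set (Fin 12))) ?_ ?_ ?_
  · rintro W hW
    simp only [Finset.coe_filter, Finset.mem_univ, true_and, Set.mem_setOf_eq] at hW
    obtain ⟨⟨hcard, hsp, hcsp⟩, hPW⟩ := hW
    refine ⟨⟨Set.subset_univ _, by rw [Set.ncard_coe_finset]; exact hcard,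
      (spanning_iff_spanDec W).mpr hsp, ?_⟩, (hP W).mpr hPW⟩
    rw [ground_sdiff_coe]; exact (spanning_iff_spanDec _).mpr hcsp
  · intro W W' _ _ h
    exact Finset.coe_inj.mp h
  · rintro S ⟨⟨-, hcard, hsp, hcsp⟩, hPS⟩
    have hfin : S.Finite := Set.toFinite S
    refine ⟨hfin.toFinset, ?_, hfin.coe_toFinset⟩
    simp only [Finset.coe_filter, Finset.mem_univ, true_and, Set.mem_setOf_eq]
    refine ⟨⟨?_, ?_, ?_⟩, ?_⟩
    · rw [← hcard, Set.ncard_eq_toFinset_card S hfin]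
    · rw [← spanning_iff_spanDec, hfin.coe_toFinset]; exact hsp
    · rw [← spanning_iff_spanDec, ← ground_sdiff_coe, hfin.coe_toFinset]; exact hcsp
    · rw [← hP, hfin.coe_toFinset]; exact hPS

/-- **`158` bi-spanning `5`-sets of `star12` contain `1`.** -/
theorem star12_count_through_one : {W ∈ biSpan star12 5 | (1 : Fin 12) ∈ W}.ncard = 158 := by
  rw [biSpan_count_eq 5 (fun W => (1 : Fin 12) ∈ W) (fun W => (1 : Fin 12) ∈ W) (fun W => by simp)]
  native_decide

/-- **`272` bi-spanning `6`-sets of `star12` avoid `1`.** -/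
theorem star12_count_six_avoid_one : {Z ∈ biSpan star12 6 | (1 : Fin 12) ∉ Z}.ncard = 272 := by
  rw [biSpan_count_eq 6 (fun W => (1 : Fin 12) ∉ W) (fun W => (1 : Fin 12) ∉ W) (fun W => by simp)]
  native_decide

/-- **(↑)₅ HOLDS ON THE STAR AT `b = 1`**: `BiIndepUpAt star12✶ 1 5`, i.e. `158 ≤ 272`, while the residue
`UpFiveSeriesPairTheta star12 0 1` is false. -/
theorem biIndepUpAt_star12_dual : BiIndepUpAt star12✶ 1 5 := by
  haveI := star12_finite
  unfold BiIndepUpAt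
  rw [biIndep_eq_biSpan_dual, biIndep_eq_biSpan_dual, Matroid.dual_dual, star12_count_through_one,
    star12_count_six_avoid_one]
  decide

end Star12

end PercRepro
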